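import Mathlib
import HarnessLib
import Summits.KontsevichZagierPeriods.KontsevichZagierPeriods.Theses.LinRedNormalForm
import Literature.NumberTheory.Transcendental.KZProduct

/-!
# Sketch — crux idea `vertex-splitting-unfolded-hyperlog` (crux stmt-KontsevichZagierPeriods-3912, `DihedralNormalForm`)

First checkable statements of the line, over existing declarations only
(`KZ.IntegralRep`, `KZ.of`, `KZ.relations`, `KZ.openOrderedSimplex`, `KZ.IntegralRep.prod`, and the LANDED move
schemas `VertexSplitting.nl_axis_osimplex` / `VertexSplitting.vertexSplit`, p125009).

Conventions: the cell is the crux's open ordered simplex `Δᵏ = {1 > t₀ > ⋯ > t_{k-1} > 0}`; the `k + 2` finite marked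
points are `P 0 = 1`, `P (i+1) = tᵢ`, `P (k+1) = 0`, so every linear form of the braid arrangement is a POSITIVE
difference `P i − P j`, `i < j` (the pair `(0, k+1)` is the constant `1`).  An integrand of the line is a Laurent
MONOMIAL in these forms (exponent matrix `γ`, upper-triangular part used); the crux's polynomial numerators are sums
of such (rule 1b).  `braidCount γ` = number of poles `(tₐ − t_b)^{-1}` between two VARIABLES (with multiplicity): the
graded residual `LogReduction k b` below is the statement the computation certifies for k = 4 (all b) and k = 5
(VertexSplittingNumerics.md / addendum 1): every convergent monomial form with `b` braid letters reduces, modulo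
`KZ.relations`, to forms with fewer braid letters, MZV words, products and lower-dimensional cells.
-/

noncomputable section

open MeasureTheory Set

namespace Summit.KontsevichZagierPeriods.KontsevichZagierPeriods.Cruxes.DihedralNormalForm.VertexSplittingSketch

open Literature.NumberTheory.Transcendental

variable {k : ℕ}

/-- The finite marked points read at `t ∈ Δᵏ`: `P 0 = 1`, `P (i+1) = tᵢ`, `P (k+1) = 0`. -/
def P (t : Fin k → ℝ) (i : Fin (k + 2)) : ℝ :=
  if h0 : (i : ℕ) = 0 then 1 else if hk : (i : ℕ) ≤ k then t ⟨(i : ℕ) - 1, by omega⟩ else 0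

/-- The Laurent monomial `∏_{i<j} (P i − P j)^{γ i j}` in the linear forms of the braid arrangement. -/
def formMonomial (k : ℕ) (γ : Fin (k + 2) → Fin (k + 2) → ℤ) (t : Fin k → ℝ) : ℝ :=
  ∏ i : Fin (k + 2), ∏ j : Fin (k + 2), if i < j then (P t i - P t j) ^ γ i j else 1

/-- Number of braid letters: poles `(tₐ − t_b)^{-e}`, `e ≥ 1`, between two VARIABLE points, counted with multiplicity. -/
def braidCount (k : ℕ) (γ : Fin (k + 2) → Fin (k + 2) → ℤ) : ℕ :=
  ∑ i : Fin (k + 2), ∑ j : Fin (k + 2),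
    if i < j ∧ (i : ℕ) ≠ 0 ∧ (j : ℕ) ≠ k + 1 ∧ γ i j < 0 then (-(γ i j)).toNat else 0

/-- Representations on `Δᵏ` whose integrand is a finite `ℚ`-combination of form monomials with exponent matrices in
`S` (absolute convergence of the COMBINATION is part of `IntegralRep`: the monomials need not converge separately —
this is the pairing the calculus forces, e.g. for the two faces of one Newton–Leibniz move). -/
def monReps (k : ℕ) (S : Set (Fin (k + 2) → Fin (k + 2) → ℤ)) : Set KZ.FormalRep :=
  {x | ∃ (n : ℕ) (q : Fin n → ℚ) (γ : Fin n → Fin (k + 2) → Fin (k + 2) → ℤ) (s : KZ.IntegralRep k),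
    (∀ i, γ i ∈ S) ∧ s.domain = KZ.openOrderedSimplex k ∧
    Set.EqOn s.integrand (fun t => ∑ i, (q i : ℝ) * formMonomial k (γ i) t) s.domain ∧ x = KZ.of s}

/-- The crux's targets: MZV word representations (verbatim shape of `DihedralNormalForm`). -/
def wordReps : Set KZ.FormalRep :=
  {x | ∃ (w : ℕ) (ε : Fin w → Bool) (q : ℚ) (s : KZ.IntegralRep w),
    s.domain = {t | (∀ i, 0 < t i) ∧ (∀ i, t i < 1) ∧ StrictAnti t} ∧
    Set.EqOn s.integrand (fun t => (q : ℝ) * ∏ i, if ε i then 1 / (1 - t i) else 1 / t i) s.domain ∧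
    x = KZ.of s}

/-- Monomial representations of all dimensions `< k` (faces; the induction on the dimension). -/
def lowerReps (k : ℕ) : Set KZ.FormalRep :=
  {x | ∃ d : ℕ, d < k ∧ x ∈ monReps d Set.univ}

/-- Products of two monomial representations of positive dimensions summing to `k` (`KZ.IntegralRep.prod`). -/
def prodReps (k : ℕ) : Set KZ.FormalRep :=
  {x | ∃ (a b : ℕ) (s : KZ.IntegralRep a) (s' : KZ.IntegralRep b), 0 < a ∧ 0 < b ∧ a + b = k ∧
    KZ.of s ∈ monReps a Set.univ ∧ KZ.of s' ∈ monReps b Set.univ ∧ x = KZ.of (s.prod s')}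

/-- The braid-letter FILTRATION: representations all of whose monomials have at most `b` braid letters. -/
def Filt (k b : ℕ) : Set KZ.FormalRep :=
  monReps k {γ | braidCount k γ ≤ b}

/-- **The graded residual `LogReduction k b`** (the inductive statement suggested by the triangularity computation,
filtration form — exactly what `tri.py` tests): every representation on `Δᵏ` by a combination of form monomials with
at most `b + 1` braid letters each is congruent modulo `KZ.relations` to a `ℤ`-combination of representations whose
monomials have at most `b` braid letters, MZV words, products and lower-dimensional representations. Certified
numerically (exact linear algebra over legal move instances mod p) for the complete convergent log sector of k = 4
(all levels) and k = 5 (levels 0, 1 at filing; 2, 3 running). -/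
def LogReduction (k b : ℕ) : Prop :=
  ∀ x ∈ Filt k (b + 1),
    ∃ m ∈ AddSubgroup.closure (Filt k b ∪ wordReps ∪ prodReps k ∪ lowerReps k), x - m ∈ KZ.relations

/-- **Level zero** (no braid letters: poles only at `tᵢ = 0, 1`; the word/Theorem-N world of the torus line). -/
def LevelZero (k : ℕ) : Prop :=
  ∀ x ∈ Filt k 0, ∃ m ∈ AddSubgroup.closure (wordReps ∪ prodReps k ∪ lowerReps k), x - m ∈ KZ.relations

/-- All representations of dimension `k` by combinations of form monomials reduce to words, products and lower
dimension (the dimension-`k` step of the crux, up to the landed entrance/exit charts). -/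
def AllLevels (k : ℕ) : Prop :=
  ∀ x ∈ monReps k Set.univ, ∃ m ∈ AddSubgroup.closure (wordReps ∪ prodReps k ∪ lowerReps k), x - m ∈ KZ.relations

/-- Bookkeeping: congruences to a generated subgroup transfer along generator-wise congruences. [folklore] -/
theorem closure_transfer {S T : Set KZ.FormalRep}
    (h : ∀ y ∈ S, ∃ m ∈ AddSubgroup.closure T, y - m ∈ KZ.relations) :
    ∀ y ∈ AddSubgroup.closure S, ∃ m ∈ AddSubgroup.closure T, y - m ∈ KZ.relations := by
  intro y hy
  induction hy using AddSubgroup.closure_induction with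
  | mem z hz => exact h z hz
  | zero => exact ⟨0, zero_mem _, by simp [KZ.relations.zero_mem]⟩
  | add a b _ _ ha hb =>
    obtain ⟨m, hm, hma⟩ := ha
    obtain ⟨m', hm', hmb⟩ := hb
    refine ⟨m + m', add_mem hm hm', ?_⟩
    have := KZ.relations.add_mem hma hmb
    convert this using 1; abel
  | neg a _ ha =>
    obtain ⟨m, hm, hma⟩ := ha
    refine ⟨-m, neg_mem hm, ?_⟩
    have := KZ.relations.neg_mem hma
    convert this using 1; abel

/-- Every representation by form monomials lies in some step of the filtration. [folklore] -/
theorem mem_filt_sum {x : KZ.FormalRep} (hx : x ∈ monReps k Set.univ) : ∃ b, x ∈ Filt k b := by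
  obtain ⟨n, q, γ, s, -, hd, hi, rfl⟩ := hx
  refine ⟨∑ i, braidCount k (γ i), n, q, γ, s, fun i => ?_, hd, hi, rfl⟩
  exact Finset.single_le_sum (f := fun i => braidCount k (γ i)) (fun _ _ => Nat.zero_le _) (Finset.mem_univ i)

/-- **TRANSFER (checked): the graded residual implies the ungraded one** — `LevelZero k` and `LogReduction k b` for
all `b` give `AllLevels k` (induction along the braid-letter filtration). -/
theorem allLevels_of_logReduction (k : ℕ) (h0 : LevelZero k) (hb : ∀ b, LogReduction k b) : AllLevels k := by
  have main : ∀ b : ℕ, ∀ x ∈ Filt k b,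
      ∃ m ∈ AddSubgroup.closure (wordReps ∪ prodReps k ∪ lowerReps k), x - m ∈ KZ.relations := by
    intro b
    induction b with
    | zero => exact h0
    | succ b IH =>
      intro x hx
      obtain ⟨m, hm, hxm⟩ := hb b x hx
      have hgen : ∀ y ∈ (Filt k b ∪ wordReps ∪ prodReps k ∪ lowerReps k),
          ∃ m' ∈ AddSubgroup.closure (wordReps ∪ prodReps k ∪ lowerReps k), y - m' ∈ KZ.relations := by
        rintro y (((hy | hy) | hy) | hy)
        · exact IH y hy
        · exact ⟨y, AddSubgroup.subset_closure (Or.inl (Or.inl hy)), by simp [KZ.relations.zero_mem]⟩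
        · exact ⟨y, AddSubgroup.subset_closure (Or.inl (Or.inr hy)), by simp [KZ.relations.zero_mem]⟩
        · exact ⟨y, AddSubgroup.subset_closure (Or.inr hy), by simp [KZ.relations.zero_mem]⟩
      obtain ⟨m', hm', hmm'⟩ := closure_transfer hgen m hm
      refine ⟨m', hm', ?_⟩
      have := KZ.relations.add_mem hxm hmm'
      convert this using 1; abel
  intro x hx
  obtain ⟨b, hb'⟩ := mem_filt_sum hx
  exact main b x hb'

end Summit.KontsevichZagierPeriods.KontsevichZagierPeriods.Cruxes.DihedralNormalForm.VertexSplittingSketch
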